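import Summits.AtomisticToContinuum.Crystallization.Theorems.ChargedEnergyGapKinkCert
import HarnessLib

/-!
# ChargedEnergyGap · NODE 86 «LineSplit» (lens-3 g85): the residual leaf (M_L) `LineMatchingQ'` SPLIT BY FIBRE MULTIPLICITY —
(M_L) ⟺ (M_S) «single-crossing capped matching» ∧ (M_L²) «multi-crossing line matching», both PROVED WEAKER, glue PROVED, cone re-pointed

Line of record `stmt-AtomisticToContinuum-14231` (`Summit.AtomisticToContinuum.ChargedEnergyGap`, route PricedLinkCensus crux r3).  Target = the
residual-deciding leaf of the lane after NODE 85: the binder `hML : LineMatchingQ' cls₀ 80 20 130 106 (1/3600000000) (1/60000000) (1/2000000)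
(1/60000000) (3/5) (1/3) 3 (3/100) 160 80 (6/5) (3/2) (679/1000) (691/1000)` of the TREE cone `chargedEnergyGap_of_kinkCert_numerics`
(`…Theorems.ChargedEnergyGapKinkCert`, NODE 85) — VERBATIM (the same binder of `chargedEnergyGap_of_kinkBudget_numerics`, NODE 84, and of
`chargedEnergyGap_of_kinkCertE_numerics`, NODE 85 file E).

THE STATED TEST OF (M_L) WAS RUN FIRST (critic row 1478: «NODE 82 earns its place iff a split / junction-family certificate beneath (M_L) lands a
WEAKER piece»; the instrument owed was the two-charged-sheet family through `lineLoad`).  Desk engine `num/zxj.py` (g85; pure Python, lattice-exact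
hole census on the planar cubic lattice of half-diagonal `ρ = 0.687`, true / frozen / LINE ledgers, the line-excess field `E(j, n)` of `lineExcessRows`
on the exact lens measure of the sites reached by both marked holes of a fibre, functional `R_• = Ξ_•/Π²`; calibration: slab `(L, c) = (118, 80.7)`
phase `0` gives `R_F = 0.957`, `R_true = 0.861`, `cov_B = 1.162` — census of record `0.967 / 0.859 / 1.165`), `num/RESULTS-g85.md`:
* a fibre carries TWO marked holes only where an axis line of the frame crosses two charged sheets STACKED along it within `2 R_N = 160` — on the
  X-junction (crystal `{|x| ≤ L} ∪ {|y| ≤ L}`, four quadrant voids) with the frame on the diagonal (`φ = 45°`, both sheets of axial kink `J = 1.41`,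
  column 6, `E(6, 2) = 23.2 c_T`) and on the plate end (two half-kink diagonals, `J = 1` exactly at adversarial alignment, `E(2, 2) = 9.2 c_T`);
  two PARALLEL charged sheets on one axis line within `160` do not exist (touching balls: separation `≥ d₁ + d₂ ≥ 187`);
* there the matching is FAT: X-junction `L = 118`, `c = 80.7`, `φ = 45°`: worst `R_L = 0.100` (margin `10`); with an adversarial central cut block
  `[-q, q]²` starving the junction (`q = 20 / 40 / 60 / 70 / 78`): worst `R_L = 0.062 / 0.137 / 0.207 / 0.216 / 0.217` (margin `≥ 4.6`; the block turns
  the crease octahedra within `80` of it χ-touching, which removes them from the lines: the excess is SELF-LIMITING under starvation); plate end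
  `(118, 80.7)`: `R_L = R_F ≤ 0.882` at the rim rising to the slab value inland, `(118, 93.5)`: `0.499` (`R_F 0.4955`, excess share `≤ 1.8 %`);
  aligned X-junction (`φ = 0`, no double fibres): `R_F ≤ 0.445` within `125` of the junction, `→ 0.957` along the arms (no overshoot);
* the excess share of `Ξ_L` is `≤ 1.8 %` on every family run; the binding family of (M_L) REMAINS the isolated lattice-aligned slab, where every axis
  line crosses the sheet once and `Ξ_L = Ξ_F` (THIN, margin `1.034` of record).

HENCE THE SPLIT (this file): the evaluation balls are divided by ONE predicate of the frame, `IsSingleCrossingBall` («every marked hole seen from a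
site of the ball is alone on its axis line»):
* (M_S) `SingleCappedMatchingQ'` — on single-crossing balls, `0 < Π(y)` and `Ξ_S(y) ≤ Π(y)²` with the SINGLE LOAD `singleLoad = restLoad + unit ×
  Σ_{marked w} capK(min-depth(w), max-kink(w))`: NO key holes, NO fibres, NO excess table — one table charge per marked hole, i.e. the hole-wise capped
  ledger of NODE 81 in the cubic frame.  PROVED below: on a single-crossing ball `lineLoad = singleLoad` at every site of the ball (`keyCharge = capK`:
  the fibre of a marked hole is `{w}`, it is its own key, `E(j, 1) = 0`), so (M_L) restricted to single-crossing balls IS (M_S)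
  (`lineMatchingSingle_iff_singleCapped`).  [RESIDUAL-DECIDING · WEAKER than (M_L) (PROVED `singleCappedMatchingQ'_of_lineMatchingQ'`) · TRUE-leaning,
  THIN: margin `1.034` (the slab family is single-crossing; census of record unchanged) · LOCAL · ATTACKABLE-L; door [COLUMN BUDGET] now costs NO
  margin: per axis line ONE charged cell `capK(d, J)` against the 1-D pool profile of the two neighbouring site lines (MEMO-g82 §7 priced the same door
  beneath (M_L) at the full `E(j, 2)` excess — that term is ABSENT here) · why it might fail: the `3.4 %` slab margin itself (a secondary ridge of kink
  `J ∈ [1.3, 1.6]` on a DIFFERENT axis inside the ball is single-crossing and charged `15–25 c_T` by the table while the pool stays that of one slab)]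
* (M_L²) `LineMatchingMultiQ'` — on the other balls (some site of the ball sees a fibre with two marked holes), (M_L) verbatim.  [WEAKER than (M_L)
  (PROVED) · TRUE-leaning, FAT: margin `≥ 4.6` on the X-junction family under the starvation scan, `2.0` on the plate end (desk, g85) · LOCAL ·
  INSTRUMENTABLE (census-1: replay `zxj.py xj 118 80.7 45 --core q`, `rimv 118 93.5`) · ATTACKABLE; door [STACKING]: two marked holes `w, w'` on one
  axis line within reach of a common site force, by the two touching balls `B(w, d(w))`, `B(w', d(w'))` and the contact directions that realise kinks
  `J, J' ≥ 1`, a separation `h ≥ …` with `J ≤ 1 + h/(2d)` (desk: realised pairs have `h ∈ [90, 160]`, `J = 1.41 ≤ 1 + h/2d`), which caps the pair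
  columns at `≤ 8` and places both crossings inside the square of a junction whose pool is that of TWO columns · why it might fail: a junction
  starved by a cut geometry finer than the central blocks scanned here (the scan is monotone in `q` and saturates at `0.217`)]
GLUE (PROVED, excluded middle on the ball predicate): `lineMatchingQ'_of_lineSplit : (M_S) → (M_L²) → (M_L)`, with the record
`lineMatchingQ'_iff_lineSplit : (M_L) ↔ (M_S) ∧ (M_L²)`.  CONE: `chargedEnergyGap_of_lineSplit_numerics` — NODE 85's 34 hypotheses with `hML`
replaced by `hMS`, `hMM` (35 binders; every other binder verbatim).

«Why novel»: the line device of NODE 82 is shown to bite only on STACKED crossings, and the split makes that geometric event — two charged sheets on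
one lattice line within `2 R_N` — the case variable: the thin residual is freed of fibres and excess (a hole-wise 1-D column problem), and the whole
line excess is quarantined in a piece whose balls are junction balls with two columns of pool.

Imports ONLY the tree file `…ChargedEnergyGapKinkCert` (NODE 85; hence `…LineMomentA`, `…FrozenMoment`, …) and `HarnessLib`; no `set_option`, no
`sorry`, no instance, no notation, no `private`; namespace `…Theorems.ChargedEnergyGapChartDial`; new declaration names.
-/

noncomputable section

open scoped Classical
open Literature.MathematicalPhysics.StatisticalMechanics Literature.Geometry.DiscreteGeometry
open Summit.AtomisticToContinuum.Crystallization.Theses.PricedLinkCensus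
open Summit.AtomisticToContinuum.Crystallization.Theorems.ChargedEnergyGapNegative

namespace Summit.AtomisticToContinuum.Crystallization.Theorems.ChargedEnergyGapChartDial

/-! ## §S1 Subsingleton fibres: the key charge of a lone marked hole is its table charge -/

section LoneHole

/-- The fibre of a marked hole all of whose fibre-mates coincide with it is `{w}`. -/
theorem lineFiber_eq_singleton {ρ : ℝ} {d : (Fin 3 → ℤ) → ℝ} {mk : (Fin 3 → ℤ) → Prop} {w : Fin 3 → ℤ} (hw : mk w)
    (hsub : ∀ w' ∈ lineFiber ρ d mk w, w' = w) : lineFiber ρ d mk w = {w} := by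
  ext w'
  refine ⟨fun h => hsub w' h, fun h => ?_⟩
  rw [Set.mem_singleton_iff] at h
  subst h
  exact ⟨hw, rfl, fun _ _ => rfl⟩

/-- … hence its marked-hole count is `1`, -/
theorem lineCount_eq_one {ρ : ℝ} {d : (Fin 3 → ℤ) → ℝ} {mk : (Fin 3 → ℤ) → Prop} {w : Fin 3 → ℤ} (hw : mk w)
    (hsub : ∀ w' ∈ lineFiber ρ d mk w, w' = w) : lineCount ρ d mk w = 1 := by
  unfold lineCount
  rw [lineFiber_eq_singleton hw hsub, Set.ncard_singleton]

/-- … it is the key hole of its fibre, -/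
theorem isKey_of_subsingleton {ρ : ℝ} {d : (Fin 3 → ℤ) → ℝ} {mk : (Fin 3 → ℤ) → Prop} {w : Fin 3 → ℤ} (hw : mk w)
    (hsub : ∀ w' ∈ lineFiber ρ d mk w, w' = w) : IsKey ρ d mk w := by
  refine ⟨hw, fun w' hw' => ?_⟩
  rw [hsub w' hw']
  exact Or.inr ⟨rfl, le_rfl⟩

/-- The line excess of a line with at most one marked hole vanishes. [definitional] -/
theorem lineExcess_of_le_one (j : ℕ) {n : ℕ} (hn : n ≤ 1) : lineExcess j n = 0 := by
  unfold lineExcess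
  rw [if_pos hn]

/-- ★ The KEY CHARGE OF A LONE MARKED HOLE is its table charge `capK(min-depth, max-kink)` — no excess. -/
theorem keyCharge_eq_capK_of_subsingleton {ρ : ℝ} {d : (Fin 3 → ℤ) → ℝ} {mk : (Fin 3 → ℤ) → Prop} {w : Fin 3 → ℤ} (hw : mk w)
    (hsub : ∀ w' ∈ lineFiber ρ d mk w, w' = w) : keyCharge ρ d mk w = capK (hDepthMin d w) (hMaxKink ρ d w) := by
  unfold keyCharge
  rw [if_pos (isKey_of_subsingleton hw hsub), lineCount_eq_one hw hsub, lineExcess_of_le_one _ le_rfl, add_zero]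

/-- The key charge of an unmarked hole is `0`. [definitional] -/
theorem keyCharge_eq_zero_of_not {ρ : ℝ} {d : (Fin 3 → ℤ) → ℝ} {mk : (Fin 3 → ℤ) → Prop} {w : Fin 3 → ℤ} (hw : ¬mk w) :
    keyCharge ρ d mk w = 0 := by
  unfold keyCharge
  rw [if_neg (fun h => hw h.1)]

end LoneHole

/-! ## §S2 The single-crossing balls, the single load / moment, the two pieces (M_S), (M_L²) -/

section LineSplit

variable (ϱχ : ℝ) {m : ℕ} (D : Fin m → Set E3) (σ : Fin m → Bool)

/-- ★ A SINGLE-CROSSING BALL: every marked hole seen from a reference site of the ball `B(y, R_N)` is ALONE on its attributed axis line (its line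
fibre is `{w}`) — every axis line of the frame that carries a marked hole within reach of the ball crosses the charged medial set once there. -/
def IsSingleCrossingBall (R_N r_f dK dstar κ c_T cχ : ℝ) (P : PeriodicConfiguration 3) (C X : Set E3) (τ ϱ r₁ r₂ : ℝ) (c₀ : E3)
    (f : Fin 3 → E3) (ρ : ℝ) (y : E3) : Prop :=
  ∀ x : E3, x ∈ P.points → dist x y ≤ R_N → ∀ w w' : Fin 3 → ℤ,
    IsMarked ϱχ D σ R_N r_f dK dstar κ c_T cχ P C X τ ϱ r₁ r₂ c₀ f ρ x w →
      w' ∈ lineFiber ρ (latDepth C c₀ f ρ) (IsMarked ϱχ D σ R_N r_f dK dstar κ c_T cχ P C X τ ϱ r₁ r₂ c₀ f ρ x) w → w' = w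

/-- ★ The **SINGLE LOAD** at `x`: the rest load plus `unit ×` ONE TABLE CHARGE `capK(min-depth, max-kink)` per marked hole at `x` — the hole-wise
capped ledger in the cubic frame; no key holes, no fibres, no excess. -/
def singleLoad (R_N unit r_f dK dstar κ c_T cχ : ℝ) (P : PeriodicConfiguration 3) (C X : Set E3) (τ ϱ r₁ r₂ : ℝ) (c₀ : E3)
    (f : Fin 3 → E3) (ρ : ℝ) (x : E3) : ℝ :=
  restLoad ϱχ D σ R_N unit r_f dK dstar κ c_T cχ P C X τ ϱ r₁ r₂ x +
    unit * ∑ᶠ w : Fin 3 → ℤ, if IsMarked ϱχ D σ R_N r_f dK dstar κ c_T cχ P C X τ ϱ r₁ r₂ c₀ f ρ x w then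
      capK (hDepthMin (latDepth C c₀ f ρ) w) (hMaxKink ρ (latDepth C c₀ f ρ) w) else 0

/-- ★ The **SINGLE MOMENT** `Ξ_S(y)`: the pool-weighted single loads of the reference sites within `R_N` of `y`. -/
def singleMoment (R_N unit r_f dK dstar κ c_T cχ : ℝ) (P : PeriodicConfiguration 3) (C X : Set E3) (τ ϱ r₁ r₂ : ℝ) (c₀ : E3)
    (f : Fin 3 → E3) (ρ : ℝ) (y : E3) : ℝ :=
  ∑ᶠ x : E3, if x ∈ P.points ∧ dist x y ≤ R_N then
    pool ϱχ D σ r_f dK dstar κ c_T cχ P C X τ ϱ r₁ r₂ x * singleLoad ϱχ D σ R_N unit r_f dK dstar κ c_T cχ P C X τ ϱ r₁ r₂ c₀ f ρ x else 0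

/-- ★ On a single-crossing ball the line load of every site of the ball IS its single load. -/
theorem lineLoad_eq_singleLoad {R_N unit r_f dK dstar κ c_T cχ : ℝ} {P : PeriodicConfiguration 3} {C X : Set E3} {τ ϱ r₁ r₂ : ℝ}
    {c₀ : E3} {f : Fin 3 → E3} {ρ : ℝ} {x : E3}
    (hx : ∀ w w' : Fin 3 → ℤ, IsMarked ϱχ D σ R_N r_f dK dstar κ c_T cχ P C X τ ϱ r₁ r₂ c₀ f ρ x w →
      w' ∈ lineFiber ρ (latDepth C c₀ f ρ) (IsMarked ϱχ D σ R_N r_f dK dstar κ c_T cχ P C X τ ϱ r₁ r₂ c₀ f ρ x) w → w' = w) :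
    lineLoad ϱχ D σ R_N unit r_f dK dstar κ c_T cχ P C X τ ϱ r₁ r₂ c₀ f ρ x =
      singleLoad ϱχ D σ R_N unit r_f dK dstar κ c_T cχ P C X τ ϱ r₁ r₂ c₀ f ρ x := by
  unfold lineLoad singleLoad
  congr 1
  congr 1
  refine finsum_congr fun w => ?_
  by_cases hm : IsMarked ϱχ D σ R_N r_f dK dstar κ c_T cχ P C X τ ϱ r₁ r₂ c₀ f ρ x w
  · rw [if_pos hm]
    exact keyCharge_eq_capK_of_subsingleton hm (fun w' hw' => hx w w' hm hw')
  · rw [if_neg hm]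
    exact keyCharge_eq_zero_of_not hm

/-- ★ On a single-crossing ball the line moment IS the single moment: `Ξ_L(y) = Ξ_S(y)`. -/
theorem lineMoment_eq_singleMoment {R_N unit r_f dK dstar κ c_T cχ : ℝ} {P : PeriodicConfiguration 3} {C X : Set E3} {τ ϱ r₁ r₂ : ℝ}
    {c₀ : E3} {f : Fin 3 → E3} {ρ : ℝ} {y : E3}
    (hy : IsSingleCrossingBall ϱχ D σ R_N r_f dK dstar κ c_T cχ P C X τ ϱ r₁ r₂ c₀ f ρ y) :
    lineMoment ϱχ D σ R_N unit r_f dK dstar κ c_T cχ P C X τ ϱ r₁ r₂ c₀ f ρ y =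
      singleMoment ϱχ D σ R_N unit r_f dK dstar κ c_T cχ P C X τ ϱ r₁ r₂ c₀ f ρ y := by
  unfold lineMoment singleMoment
  refine finsum_congr fun x => ?_
  by_cases hx : x ∈ P.points ∧ dist x y ≤ R_N
  · rw [if_pos hx, if_pos hx, lineLoad_eq_singleLoad ϱχ D σ (hy x hx.1 hx.2)]
  · rw [if_neg hx, if_neg hx]

variable {ϱχ D σ}

/-- ★★★ **(M_S) THE SINGLE-CROSSING CAPPED MATCHING** — piece 1 of NODE 86: for every reference of the class with a cubic frame `(c₀, f, ρ₀)` and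
every HEAVY ACTIVE CREASED ordered mid pair `(y, z)` whose ball is SINGLE-CROSSING: `0 < Π(y)` and `Ξ_S(y) ≤ Π(y)²` — the ball pool against the
SINGLE MOMENT (rest load + one table charge `capK(min-depth, max-kink)` per marked hole; no lines, no excess).  Equal to (M_L) restricted to
single-crossing balls (`lineMatchingSingle_iff_singleCapped`); the binding slab family of (M_L) lies here (margin `1.034` of record).
[RESIDUAL-DECIDING · WEAKER than (M_L) (PROVED) · TRUE-leaning, THIN `1.034` · LOCAL · ATTACKABLE-L; door [COLUMN BUDGET] at no margin cost (no
`E(j, n)` term) · why it might fail: the slab margin itself — a single-crossing secondary ridge `J ∈ [1.3, 1.6]` on another axis inside the ball] -/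
def SingleCappedMatchingQ' (cls : Set E3 → Prop) (R_N r_f dK dstar κ c_T cχ unit : ℝ) (s lam ℓ τ ϱ ϱχ r₁ r₂ ρlo ρhi : ℝ) : Prop :=
  ∀ (P : PeriodicConfiguration 3) (C X : Set E3) (m : ℕ) (D : Fin m → Set E3) (σ : Fin m → Bool),
    IsSeparatedRef s P → IsLabelledRef lam ℓ P → cls P.points → IsForceFree P → IsSiteStressFree P →
    IsInvariantSet P C → IsInvariantSet P X → (∀ i, IsInvariantSet P (D i)) → (∀ i, IsConvexPieces (2 * ϱχ) (D i)) →
    IsFramedOct P r₁ r₂ ρlo ρhi →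
    ∀ (c₀ : E3) (f : Fin 3 → E3) (ρ₀ : ℝ), Orthonormal ℝ f → ρlo ≤ ρ₀ → ρ₀ ≤ ρhi → IsCubicFrameOf P r₁ r₂ c₀ f ρ₀ →
    ∀ y z : E3, HeavyActive ϱχ D σ r_f dK dstar κ c_T cχ P C X τ ϱ r₁ r₂ y z → ¬OctTame r_f C P r₁ y z →
      IsSingleCrossingBall ϱχ D σ R_N r_f dK dstar κ c_T cχ P C X τ ϱ r₁ r₂ c₀ f ρ₀ y →
      0 < ballPool ϱχ D σ R_N r_f dK dstar κ c_T cχ P C X τ ϱ r₁ r₂ y ∧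
        singleMoment ϱχ D σ R_N unit r_f dK dstar κ c_T cχ P C X τ ϱ r₁ r₂ c₀ f ρ₀ y ≤
          ballPool ϱχ D σ R_N r_f dK dstar κ c_T cχ P C X τ ϱ r₁ r₂ y ^ 2

/-- ★ (M_L¹) THE SINGLE-CROSSING LINE MATCHING: (M_L) verbatim, restricted to single-crossing balls (the intermediate form; `↔ (M_S)` below). -/
def LineMatchingSingleQ' (cls : Set E3 → Prop) (R_N r_f dK dstar κ c_T cχ unit : ℝ) (s lam ℓ τ ϱ ϱχ r₁ r₂ ρlo ρhi : ℝ) : Prop :=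
  ∀ (P : PeriodicConfiguration 3) (C X : Set E3) (m : ℕ) (D : Fin m → Set E3) (σ : Fin m → Bool),
    IsSeparatedRef s P → IsLabelledRef lam ℓ P → cls P.points → IsForceFree P → IsSiteStressFree P →
    IsInvariantSet P C → IsInvariantSet P X → (∀ i, IsInvariantSet P (D i)) → (∀ i, IsConvexPieces (2 * ϱχ) (D i)) →
    IsFramedOct P r₁ r₂ ρlo ρhi →
    ∀ (c₀ : E3) (f : Fin 3 → E3) (ρ₀ : ℝ), Orthonormal ℝ f → ρlo ≤ ρ₀ → ρ₀ ≤ ρhi → IsCubicFrameOf P r₁ r₂ c₀ f ρ₀ →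
    ∀ y z : E3, HeavyActive ϱχ D σ r_f dK dstar κ c_T cχ P C X τ ϱ r₁ r₂ y z → ¬OctTame r_f C P r₁ y z →
      IsSingleCrossingBall ϱχ D σ R_N r_f dK dstar κ c_T cχ P C X τ ϱ r₁ r₂ c₀ f ρ₀ y →
      0 < ballPool ϱχ D σ R_N r_f dK dstar κ c_T cχ P C X τ ϱ r₁ r₂ y ∧
        lineMoment ϱχ D σ R_N unit r_f dK dstar κ c_T cχ P C X τ ϱ r₁ r₂ c₀ f ρ₀ y ≤
          ballPool ϱχ D σ R_N r_f dK dstar κ c_T cχ P C X τ ϱ r₁ r₂ y ^ 2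

/-- ★★★ **(M_L²) THE MULTI-CROSSING LINE MATCHING** — piece 2 of NODE 86: (M_L) verbatim, restricted to the balls that are NOT single-crossing (some
reference site of the ball sees an axis line carrying two marked holes: two charged sheets stacked on one lattice line within `2 R_N` — junction
balls).  [WEAKER than (M_L) (PROVED) · TRUE-leaning, FAT: X-junction family with central starvation blocks `R_L ≤ 0.217` (margin `≥ 4.6`), plate end
`≤ 0.50` (desk g85, `num/RESULTS-g85.md`) · LOCAL · INSTRUMENTABLE · ATTACKABLE; door [STACKING] (touching-ball separation of stacked crossings) ·
why it might fail: a starvation geometry of the junction finer than the central blocks scanned] -/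
def LineMatchingMultiQ' (cls : Set E3 → Prop) (R_N r_f dK dstar κ c_T cχ unit : ℝ) (s lam ℓ τ ϱ ϱχ r₁ r₂ ρlo ρhi : ℝ) : Prop :=
  ∀ (P : PeriodicConfiguration 3) (C X : Set E3) (m : ℕ) (D : Fin m → Set E3) (σ : Fin m → Bool),
    IsSeparatedRef s P → IsLabelledRef lam ℓ P → cls P.points → IsForceFree P → IsSiteStressFree P →
    IsInvariantSet P C → IsInvariantSet P X → (∀ i, IsInvariantSet P (D i)) → (∀ i, IsConvexPieces (2 * ϱχ) (D i)) →
    IsFramedOct P r₁ r₂ ρlo ρhi →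
    ∀ (c₀ : E3) (f : Fin 3 → E3) (ρ₀ : ℝ), Orthonormal ℝ f → ρlo ≤ ρ₀ → ρ₀ ≤ ρhi → IsCubicFrameOf P r₁ r₂ c₀ f ρ₀ →
    ∀ y z : E3, HeavyActive ϱχ D σ r_f dK dstar κ c_T cχ P C X τ ϱ r₁ r₂ y z → ¬OctTame r_f C P r₁ y z →
      ¬IsSingleCrossingBall ϱχ D σ R_N r_f dK dstar κ c_T cχ P C X τ ϱ r₁ r₂ c₀ f ρ₀ y →
      0 < ballPool ϱχ D σ R_N r_f dK dstar κ c_T cχ P C X τ ϱ r₁ r₂ y ∧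
        lineMoment ϱχ D σ R_N unit r_f dK dstar κ c_T cχ P C X τ ϱ r₁ r₂ c₀ f ρ₀ y ≤
          ballPool ϱχ D σ R_N r_f dK dstar κ c_T cχ P C X τ ϱ r₁ r₂ y ^ 2

/-! ## §S3 The glue (PROVED): (M_S) ↔ (M_L¹), (M_S) ∧ (M_L²) → (M_L), and the WEAKER certificates -/

variable {cls : Set E3 → Prop} {R_N r_f dK dstar κ c_T cχ unit s lam ℓ τ ϱ ϱχ r₁ r₂ ρlo ρhi : ℝ}

/-- ★ (M_L¹) ↔ (M_S): on single-crossing balls the line moment is the single moment. -/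
theorem lineMatchingSingle_iff_singleCapped :
    LineMatchingSingleQ' cls R_N r_f dK dstar κ c_T cχ unit s lam ℓ τ ϱ ϱχ r₁ r₂ ρlo ρhi ↔
      SingleCappedMatchingQ' cls R_N r_f dK dstar κ c_T cχ unit s lam ℓ τ ϱ ϱχ r₁ r₂ ρlo ρhi := by
  constructor
  · intro h P C X m D σ hs hl hc hff hss hC hX hD hDc hfr c₀ f ρ₀ hf hlo hhi hcf y z hha hnt hsc
    have h' := h P C X m D σ hs hl hc hff hss hC hX hD hDc hfr c₀ f ρ₀ hf hlo hhi hcf y z hha hnt hsc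
    rw [lineMoment_eq_singleMoment ϱχ D σ hsc] at h'
    exact h'
  · intro h P C X m D σ hs hl hc hff hss hC hX hD hDc hfr c₀ f ρ₀ hf hlo hhi hcf y z hha hnt hsc
    have h' := h P C X m D σ hs hl hc hff hss hC hX hD hDc hfr c₀ f ρ₀ hf hlo hhi hcf y z hha hnt hsc
    rw [← lineMoment_eq_singleMoment ϱχ D σ hsc] at h'
    exact h'

/-- ★★★ **THE GLUE OF NODE 86** (PROVED, excluded middle on the ball predicate): (M_S) → (M_L²) → (M_L). -/
theorem lineMatchingQ'_of_lineSplit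
    (hMS : SingleCappedMatchingQ' cls R_N r_f dK dstar κ c_T cχ unit s lam ℓ τ ϱ ϱχ r₁ r₂ ρlo ρhi)
    (hMM : LineMatchingMultiQ' cls R_N r_f dK dstar κ c_T cχ unit s lam ℓ τ ϱ ϱχ r₁ r₂ ρlo ρhi) :
    LineMatchingQ' cls R_N r_f dK dstar κ c_T cχ unit s lam ℓ τ ϱ ϱχ r₁ r₂ ρlo ρhi := by
  have hM1 := lineMatchingSingle_iff_singleCapped.2 hMS
  intro P C X m D σ hs hl hc hff hss hC hX hD hDc hfr c₀ f ρ₀ hf hlo hhi hcf y z hha hnt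
  by_cases hsc : IsSingleCrossingBall ϱχ D σ R_N r_f dK dstar κ c_T cχ P C X τ ϱ r₁ r₂ c₀ f ρ₀ y
  · exact hM1 P C X m D σ hs hl hc hff hss hC hX hD hDc hfr c₀ f ρ₀ hf hlo hhi hcf y z hha hnt hsc
  · exact hMM P C X m D σ hs hl hc hff hss hC hX hD hDc hfr c₀ f ρ₀ hf hlo hhi hcf y z hha hnt hsc

/-- ★ WEAKER certificate: (M_L) → (M_S). -/
theorem singleCappedMatchingQ'_of_lineMatchingQ'
    (h : LineMatchingQ' cls R_N r_f dK dstar κ c_T cχ unit s lam ℓ τ ϱ ϱχ r₁ r₂ ρlo ρhi) :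
    SingleCappedMatchingQ' cls R_N r_f dK dstar κ c_T cχ unit s lam ℓ τ ϱ ϱχ r₁ r₂ ρlo ρhi :=
  lineMatchingSingle_iff_singleCapped.1
    fun P C X m D σ hs hl hc hff hss hC hX hD hDc hfr c₀ f ρ₀ hf hlo hhi hcf y z hha hnt _ =>
      h P C X m D σ hs hl hc hff hss hC hX hD hDc hfr c₀ f ρ₀ hf hlo hhi hcf y z hha hnt

/-- ★ WEAKER certificate: (M_L) → (M_L²). -/
theorem lineMatchingMultiQ'_of_lineMatchingQ'
    (h : LineMatchingQ' cls R_N r_f dK dstar κ c_T cχ unit s lam ℓ τ ϱ ϱχ r₁ r₂ ρlo ρhi) :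
    LineMatchingMultiQ' cls R_N r_f dK dstar κ c_T cχ unit s lam ℓ τ ϱ ϱχ r₁ r₂ ρlo ρhi :=
  fun P C X m D σ hs hl hc hff hss hC hX hD hDc hfr c₀ f ρ₀ hf hlo hhi hcf y z hha hnt _ =>
    h P C X m D σ hs hl hc hff hss hC hX hD hDc hfr c₀ f ρ₀ hf hlo hhi hcf y z hha hnt

/-- ★ THE RECORD: (M_L) ↔ (M_S) ∧ (M_L²). -/
theorem lineMatchingQ'_iff_lineSplit :
    LineMatchingQ' cls R_N r_f dK dstar κ c_T cχ unit s lam ℓ τ ϱ ϱχ r₁ r₂ ρlo ρhi ↔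
      SingleCappedMatchingQ' cls R_N r_f dK dstar κ c_T cχ unit s lam ℓ τ ϱ ϱχ r₁ r₂ ρlo ρhi ∧
        LineMatchingMultiQ' cls R_N r_f dK dstar κ c_T cχ unit s lam ℓ τ ϱ ϱχ r₁ r₂ ρlo ρhi :=
  ⟨fun h => ⟨singleCappedMatchingQ'_of_lineMatchingQ' h, lineMatchingMultiQ'_of_lineMatchingQ' h⟩,
    fun h => lineMatchingQ'_of_lineSplit h.1 h.2⟩

end LineSplit

/-! ## §S4 The cone after NODE 86 -/

section Cone86

/-- ★★★ **THE CONE AFTER NODE 86**: `ChargedEnergyGap` from NODE 85's cone `chargedEnergyGap_of_kinkCert_numerics` with its residual leaf `hML`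
(M_L) supplied by the two pieces of this node — 35 hypotheses (NODE 85's 34 with `hML` replaced by `hMS : SingleCappedMatchingQ' …` (M_S) and
`hMM : LineMatchingMultiQ' …` (M_L²), designate parameters verbatim; every other binder verbatim). -/
theorem chargedEnergyGap_of_lineSplit_numerics {b₁ : ℝ} (hb : 1 / 8 ≤ b₁) (hU : Fcc.FccScaleNumerics) (hF : ChargeRecount)
    (hIP : ImprovablePricingG (3 / 20) (1 / 10) (6 / 5) 10 (1 / 100) (3 / 5))
    (hFCP : FrustratedCorePricingG (3 / 20) (1 / 10) (6 / 5) 10 (1 / 100) 40 (3 / 5))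
    (hCCP : CoherentCorePricingG (3 / 20) (1 / 10) (6 / 5) 10 (1 / 100) 40 (1 / 10) 40 (3 / 5))
    (hB : CoreBallRegularPricingW (maxCoverWeights (3 / 20) (1 / 10) (6 / 5) 10 (1 / 100) 40 (1 / 10) 40 160) (1 / 20) (3 / 5) 10
      fun _ _ => True)
    (hLab : CleanLabellingW (maxCoverWeights (3 / 20) (1 / 10) (6 / 5) 10 (1 / 100) 40 (1 / 10) 40 160) (3 / 5) 10 (1 / 3) 3)
    (hSB : ShellBudgetW (maxCoverWeights (3 / 20) (1 / 10) (6 / 5) 10 (1 / 100) 40 (1 / 10) 40 160) (3 / 5) 100000)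
    (hLf : LoadBoundQ IsFccImage (3 / 5) (1 / 3) 3 (1 / 100) (3 / 100) 160 (2 / 5) 3 b₁ 80 (6 / 5) (3 / 4) (3 / 10000000) (9 / 1000000))
    (hNf : NnStiffCls IsFccImage (27 / 10) (6 / 5))
    (hOL : OctLedgerQ (IsCubicFccImage (1921 / 2000) (977 / 1000)) (3 / 5) (1 / 3) 3 (1 / 100) (3 / 100) 160 (2 / 5) 3 b₁ 80 (6 / 5) (3 / 2)
      (1 / 2) (679 / 1000) (691 / 1000))
    (hA : A0Plus)
    (hT : RoofTableQ (471 / 1000) T75)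
    (hZ : SixFeetZeroConeQ (679 / 1000) (691 / 1000) 20 106 160)
    (hCap : SixFeetShallowCapQ (679 / 1000) (691 / 1000) 20 106 160 (3 / 100) (1 / 3600000000))
    (hI : SVertexIncidenceQ cls₀ 20 106 36 (3 / 5) (1 / 3) 3 160 80 (6 / 5) (3 / 2))
    (hZK : SixFeetZeroConeQ (679 / 1000) (691 / 1000) 330 130 160)
    (hSF : BallSupportQ 80 20 130 106 (1 / 3600000000) (1 / 60000000) (1 / 2000000) (3 / 5) (3 / 100) 160 80 (6 / 5) (3 / 2))
    (hKC : KinkCostTableQ (679 / 1000) (691 / 1000) 160 (3 / 100) (1 / 60000000))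
    (hO3 : ThreeHoleOuterQ (679 / 1000) (691 / 1000)) (hM3 : ThreeHoleMidThreeQ (679 / 1000) (691 / 1000))
    (hMS : SingleCappedMatchingQ' cls₀ 80 20 130 106 (1 / 3600000000) (1 / 60000000) (1 / 2000000) (1 / 60000000) (3 / 5) (1 / 3) 3
      (3 / 100) 160 80 (6 / 5) (3 / 2) (679 / 1000) (691 / 1000))
    (hMM : LineMatchingMultiQ' cls₀ 80 20 130 106 (1 / 3600000000) (1 / 60000000) (1 / 2000000) (1 / 60000000) (3 / 5) (1 / 3) 3
      (3 / 100) 160 80 (6 / 5) (3 / 2) (679 / 1000) (691 / 1000))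
    (hPD : BandBallQ' cls₀ 80 20 130 106 (1 / 3600000000) (1 / 60000000) (1 / 2000000) (3 / 5) (1 / 3) 3 (3 / 100) 160 80 (6 / 5)
      (3 / 2) (679 / 1000) (691 / 1000))
    (hNP : BallIncidenceQ' cls₀ 80 20 130 106 (1 / 3600000000) (1 / 60000000) (1 / 2000000) (3 / 5) (1 / 3) 3 (3 / 100) 160 80 (6 / 5)
      (3 / 2) (679 / 1000) (691 / 1000))
    (hFf : FarTrussQ IsFccImage (3 / 5) (1 / 3) 3 (1 / 100) (3 / 100) 160 (2 / 5) 3 b₁ 80 (6 / 5) (3 / 2) (11 / 20) (1 / 25) (1 / 60000000)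
      (1 / 2000000))
    (hGf : GeoExchQ IsFccImage (3 / 5) (1 / 3) 3 (1 / 100) (3 / 100) 160 (2 / 5) 3 b₁ 80 (6 / 5) (3 / 20) (1 / 25) (1 / 30000000) (1 / 1000000))
    (hLh : LoadBoundQ IsHcpImage (3 / 5) (1 / 3) 3 (1 / 100) (3 / 100) 160 (2 / 5) 3 b₁ 80 (6 / 5) (3 / 4) (3 / 10000000) (9 / 1000000))
    (hNh : NnStiffCls IsHcpImage (27 / 10) (6 / 5))
    (hMh : MidTrussQ IsHcpImage (3 / 5) (1 / 3) 3 (1 / 100) (3 / 100) 160 (2 / 5) 3 b₁ 80 (6 / 5) (3 / 2) (1 / 2) 0 (1 / 60000000) (1 / 2000000))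
    (hFh : FarTrussQ IsHcpImage (3 / 5) (1 / 3) 3 (1 / 100) (3 / 100) 160 (2 / 5) 3 b₁ 80 (6 / 5) (3 / 2) (1 / 2) (1 / 40) (1 / 60000000)
      (1 / 2000000))
    (hGh : GeoExchQ IsHcpImage (3 / 5) (1 / 3) 3 (1 / 100) (3 / 100) 160 (2 / 5) 3 b₁ 80 (6 / 5) (1 / 5) (1 / 40) (1 / 30000000) (1 / 1000000))
    (hN : LocalSeamReductionQ' (3 / 5) (1 / 3) 3 (1 / 100) (3 / 100) (1 / 2) 160 (2 / 5) 3 b₁ 80 (1 / 3000000) (1 / 100000)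
      (maxCoverWeights (3 / 20) (1 / 10) (6 / 5) 10 (1 / 100) 40 (1 / 10) 40 160) (1 / 20) 10 100000)
    (hP : ChartedChargePricingG (3 / 20) (1 / 10) (3 / 5))  : ChargedEnergyGap :=
  chargedEnergyGap_of_kinkCert_numerics hb hU hF hIP hFCP hCCP hB hLab hSB hLf hNf hOL hA hT hZ hCap hI hZK hSF hKC hO3 hM3
    (lineMatchingQ'_of_lineSplit hMS hMM) hPD hNP hFf hGf hLh hNh hMh hFh hGh hN hP

end Cone86

end Summit.AtomisticToContinuum.Crystallization.Theorems.ChargedEnergyGapChartDial
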